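import Mathlib
import Summits.Ventures.PercRepro2.CoinTreeCore
import Summits.Ventures.PercRepro2.CoinOrTailKDefs
import Summits.Ventures.PercRepro2.CoinChainTower

/-!
# A pendant OR-tower of two vertices with covering markers: an instantiation (blind cell
PercRepro2, night-2 g17; NIGHT2-DARC.md §57.11)

Fourteen coins on `Fin 10` (s = 0, m₁ = 1, m₂ = 2, q = 3, v₁ = 4, v₂ = 5, a = 6, h = 7, w = 8,
t = 9): the out-tree core `s → m₁`, `s → m₂`, `m₁ → q`; the tower `v₁` (entered from `m₁, m₂`),
`v₂` (entered from `v₁` and `m₂`), the free-arc vertex `a` (entered from `v₂` and `m₁`) — seven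
random coins on the tower; the head `v₁ → h → t`, `v₂ → t`, `a → t`, `w → t`.  Row 2′DARC at
`a → w` for the markers `(m₁, m₂)` for EVERY probability vector, no hypothesis
(`darc_tower_example`).
-/

namespace Summit.Ventures.PercRepro2.Coin

namespace TowerExample

open Classical

/-- The fourteen coins of the example. -/
def arcsT : Fin 14 → Finset (Fin 10 × Fin 10)
  | 0 => {(0, 1)}   -- s → m₁
  | 1 => {(0, 2)}   -- s → m₂
  | 2 => {(1, 3)}   -- m₁ → q
  | 3 => {(1, 4)}   -- m₁ → v₁
  | 4 => {(2, 4)}   -- m₂ → v₁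
  | 5 => {(4, 5)}   -- v₁ → v₂
  | 6 => {(2, 5)}   -- m₂ → v₂
  | 7 => {(5, 6)}   -- v₂ → a
  | 8 => {(1, 6)}   -- m₁ → a
  | 9 => {(4, 7)}   -- v₁ → h
  | 10 => {(7, 9)}  -- h → t
  | 11 => {(6, 9)}  -- a → t
  | 12 => {(8, 9)}  -- w → t
  | 13 => {(5, 9)}  -- v₂ → t
  | _ => ∅

/-- The entry coins of `v₁`. -/
def c₁T : Fin 10 → Fin 14
  | 1 => 3
  | 2 => 4
  | _ => 0

/-- The entry coins of `v₂`. -/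
def c₂T : Fin 10 → Fin 14
  | 4 => 5
  | 2 => 6
  | _ => 0

/-- The entry coins of `a`. -/
def cT : Fin 10 → Fin 14
  | 5 => 7
  | 1 => 8
  | _ => 0

/-- The tree coins. -/
def tcT : Fin 10 → Fin 14
  | 1 => 0
  | 2 => 1
  | 3 => 2
  | _ => 0

/-- The parent map. -/
def parT : Fin 10 → Fin 10
  | 3 => 1
  | _ => 0

/-- The rank. -/
def rkT : Fin 10 → ℕ
  | 1 => 1
  | 2 => 1
  | 3 => 2
  | _ => 0

/-- Every coin is a single arc. -/
lemma sameEnds_t : SameEnds arcsT := by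
  intro e xy hxy x'y' hx'y'
  fin_cases e <;> simp [arcsT] at hxy hx'y' <;> subst hxy <;> subst hx'y' <;>
    exact ⟨Or.inl rfl, Or.inr rfl⟩

set_option maxRecDepth 20000 in
/-- The out-tree core `{m₁, m₂, q}`. -/
lemma treeCore_t : TreeCore arcsT 0 {1, 2, 3} tcT parT rkT where
  tree := by decide
  par_mem := by decide
  rank := by decide
  into_C := by decide
  into_s := by decide
  s_notin := by decide

set_option maxRecDepth 20000 in
/-- `v₁ = 4` is an OR-vertex of the core entered from `m₁, m₂`. -/
lemma orTailK₁_t : OrTailK arcsT 0 {1, 2, 3} {1, 2} c₁T 4 where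
  ent_sub := by decide
  s_notin := by decide
  a_notin := by decide
  a_ne_s := by decide
  into_U := by decide
  into_s := by decide
  into_a := by decide
  arcs_c := by decide
  c_inj := by decide

set_option maxRecDepth 20000 in
/-- `v₂ = 5` is an OR-vertex of `U ∪ {v₁}` entered from `v₁` and `m₂`. -/
lemma orTailK₂_t : OrTailK arcsT 0 (insert 4 {1, 2, 3}) {4, 2} c₂T 5 where
  ent_sub := by decide
  s_notin := by decide
  a_notin := by decide
  a_ne_s := by decide
  into_U := by decide
  into_s := by decide
  into_a := by decide
  arcs_c := by decide
  c_inj := by decide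

set_option maxRecDepth 20000 in
/-- `a = 6` is an OR-vertex of `U ∪ {v₁, v₂}` entered from `v₂` and `m₁`. -/
lemma orTailK_t : OrTailK arcsT 0 (insert 5 (insert 4 {1, 2, 3})) {5, 1} cT 6 where
  ent_sub := by decide
  s_notin := by decide
  a_notin := by decide
  a_ne_s := by decide
  into_U := by decide
  into_s := by decide
  into_a := by decide
  arcs_c := by decide
  c_inj := by decide

/-- The tower `[v₁, v₂]` over the core. -/
lemma orTower_t : OrTower arcsT 0 {1, 2, 3} [({1, 2}, c₁T, 4), ({4, 2}, c₂T, 5)] :=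
  OrTower.cons _ _ _ _ _ orTailK₁_t (OrTower.cons _ _ _ _ _ orTailK₂_t (OrTower.nil _))

/-- **Row 2′DARC at `a → w` for the markers `(m₁, m₂)` on the fourteen-coin tower instance,
every probability vector — no hypothesis.** -/
theorem darc_tower_example {R : Type*} [Field R] [LinearOrder R] [IsStrictOrderedRing R]
    (pr : Fin 14 → R) (hp : IsProbVec pr) : DARC pr arcsT 0 {9} 1 2 6 8 :=
  darc_of_towerCover pr hp sameEnds_t orTower_t orTailK_t (by decide) (by decide)
    (by
      intro x hx
      simp only [List.mem_cons, List.not_mem_nil, or_false] at hx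
      rcases hx with rfl | rfl <;> decide)
    (by decide) (treeCore_t.coreLevel_lsm pr hp) (by decide) (by decide) (by decide) (by decide)

end TowerExample

end Summit.Ventures.PercRepro2.Coin
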